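import Summits.AtomisticToContinuum.Crystallization.Theorems.FreeSplittingCertificatesRadiusLadderHalfRule

/-!
# `FiniteRangeSplitting` (stmt-AtomisticToContinuum-12559): below the separation scale the rung IS the half rule

Support file for crux r2 of route `FreeSplittingCertificates` (block-2b unit `b2b-freesplit-A`, gen 12).
VALUE = a structural theorem about the crux's instances — NOT summit progress.

`RungAt δ R = ∃ Φ, IsRule Φ ∧ Feasible δ R Φ` (`…RadiusLadder`).  For pattern radii BELOW the hard core,
`0 < R < δ`, every bond pattern of a `δ`-separated configuration is the trivial `{0, v}`
(`bondPattern_of_lt_sep`), inversion averaging turns any feasible rule into the half rule on such patterns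
(`eInf_le_half_sum_of_symmetric`), and so the rung does not depend on the rule at all:

* `rungAt_iff_halfSumFeasible_of_lt` — for `0 < R < δ`:  `RungAt δ R ↔ HalfSumFeasible δ`, the
  DEEPEST-SITE INEQUALITY "every site of every `δ`-separated finite configuration has half pair-sum
  `½ Σ_j V(r_ij) ≥ e_∞`";  equivalently (`rungAt_iff_feasible_halfRule_of_lt`) `RungAt δ R ↔ Feasible δ R' halfRule`
  for any `R'` (the half rule's feasibility is radius-blind, `feasible_halfRule_iff`).
* `rungAt_indep_of_lt` — hence `RungAt δ R ↔ RungAt δ R'` for all `R, R' ∈ (-∞, δ)`, and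
  `rungAt_all_of_rungAt_lt` — a rung below the separation scale is a rung at EVERY radius.
* `halfSumFeasible_mono` — `{δ | HalfSumFeasible δ}` is an up-set; with `…RadiusLadderHalfRule` it contains
  `[4/3, ∞)` and misses `(-∞, 23/25]` (`halfSumFeasible_of_four_thirds_le`, `not_halfSumFeasible_of_le_23_25`),
  so it is `[δ_½, ∞)` or `(δ_½, ∞)` for ONE threshold `23/25 ≤ δ_½ ≤ 4/3`; `not_halfSumFeasible_of_deepSite` is the
  star criterion in this language (a site with half pair-sum `< B ≤ e_∞` kills every `δ' ≤ δ`).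

Consequence for the crux `∀ δ > 0, ∃ R > 0, RungAt δ R` (`finiteRangeSplitting_iff_rung`): for `δ ≥ δ_½` (strictly,
if the threshold is not attained) the instance is decided by the half rule at any radius; for `δ < δ_½` every rung
needs `R ≥ δ` (`radius_ge_of_rungAt`) — the rule must see at least the first neighbours, which is the regime of the
recurrent-pattern LP (`…RadiusLadder`, `…RadiusLadderFarkas`).  Deciding `δ_½` itself is the deepest-site problem
`sup_X ½ Σ_{p ∈ X} (-V(|p|))` over `δ`-separated `X ∌ 0` with `|p| ≥ δ` versus `|e_∞| ∈ [0.7175, 0.786477224]`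
(`eInf_le_ref`, `twoConeB_le_eInf`).
-/

noncomputable section

namespace Summit.AtomisticToContinuum.Crystallization.Theorems.StrictSplittingRuleBirth

open scoped BigOperators Classical
open Literature.MathematicalPhysics.StatisticalMechanics

/-- **Deepest-site inequality at hard core `δ`**: every site of every `δ`-separated finite configuration has
half pair-sum `≥ e_∞`. [folklore] -/
def HalfSumFeasible (δ : ℝ) : Prop :=
  ∀ (N : ℕ) (x : Fin N → EuclideanSpace ℝ (Fin 3)), Sep δ x → ∀ i : Fin N,
    eInf ≤ (∑ j ∈ Finset.univ.erase i, lennardJones (dist (x i) (x j))) / 2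

/-- The half rule's feasibility is the deepest-site inequality, at every radius. -/
theorem feasible_halfRule_iff (δ R : ℝ) : Feasible δ R halfRule ↔ HalfSumFeasible δ := by
  simp only [Feasible, HalfSumFeasible, siteE_halfRule]

/-- The half rule's feasibility does not depend on the radius. -/
theorem feasible_halfRule_indep (δ R R' : ℝ) : Feasible δ R halfRule ↔ Feasible δ R' halfRule := by
  rw [feasible_halfRule_iff, feasible_halfRule_iff]

/-- `HalfSumFeasible` is monotone in the hard core. -/
theorem halfSumFeasible_mono {δ δ' : ℝ} (h : δ ≤ δ') (hf : HalfSumFeasible δ) : HalfSumFeasible δ' :=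
  fun N x hx i => hf N x (fun a b hab => h.trans (hx a b hab)) i

/-- The deepest-site inequality gives a rung at EVERY radius (witness: the half rule). -/
theorem rungAt_of_halfSumFeasible {δ : ℝ} (h : HalfSumFeasible δ) (R : ℝ) : RungAt δ R :=
  ⟨halfRule, isRule_halfRule, (feasible_halfRule_iff δ R).2 h⟩

/-- Below the separation scale ANY feasible rule forces the deepest-site inequality (inversion averaging on the
trivial patterns `{0, v}`). -/
theorem halfSumFeasible_of_rungAt {δ R : ℝ} (hδ : 0 < δ) (hR : R < δ) (h : RungAt δ R) : HalfSumFeasible δ :=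
  fun _ x hx i => eInf_le_half_sum_of_symmetric hδ h x hx i fun _ hj => bondPattern_of_lt_sep hR hx hj

/-- **Below the separation scale the rung is the deepest-site inequality**: for `0 < R < δ`,
`RungAt δ R ↔ HalfSumFeasible δ`. -/
theorem rungAt_iff_halfSumFeasible_of_lt {δ R : ℝ} (hδ : 0 < δ) (hR : R < δ) :
    RungAt δ R ↔ HalfSumFeasible δ :=
  ⟨halfSumFeasible_of_rungAt hδ hR, fun h => rungAt_of_halfSumFeasible h R⟩

/-- … equivalently the rung is the half rule (read at any radius `R'`). -/
theorem rungAt_iff_feasible_halfRule_of_lt {δ R : ℝ} (hδ : 0 < δ) (hR : R < δ) (R' : ℝ) :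
    RungAt δ R ↔ Feasible δ R' halfRule := by
  rw [rungAt_iff_halfSumFeasible_of_lt hδ hR, feasible_halfRule_iff]

/-- **Radius independence below the hard core**: `RungAt δ R ↔ RungAt δ R'` for `R, R' < δ`. -/
theorem rungAt_indep_of_lt {δ R R' : ℝ} (hδ : 0 < δ) (hR : R < δ) (hR' : R' < δ) :
    RungAt δ R ↔ RungAt δ R' := by
  rw [rungAt_iff_halfSumFeasible_of_lt hδ hR, rungAt_iff_halfSumFeasible_of_lt hδ hR']

/-- A rung below the separation scale is a rung at every radius. -/
theorem rungAt_all_of_rungAt_lt {δ R : ℝ} (hδ : 0 < δ) (hR : R < δ) (h : RungAt δ R) (R' : ℝ) :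
    RungAt δ R' :=
  rungAt_of_halfSumFeasible (halfSumFeasible_of_rungAt hδ hR h) R'

/-- Contrapositive: where the deepest-site inequality fails, every rung needs a pattern radius `R ≥ δ`
(the rule must see at least the first neighbours). -/
theorem radius_ge_of_rungAt {δ R : ℝ} (hδ : 0 < δ) (hns : ¬ HalfSumFeasible δ) (h : RungAt δ R) : δ ≤ R := by
  by_contra hlt
  exact hns (halfSumFeasible_of_rungAt hδ (not_le.mp hlt) h)

/-- **Star criterion** in this language: one site of one `δ`-separated configuration with half pair-sum below the
certified floor `B ≤ e_∞` refutes the deepest-site inequality at `δ` (and, by monotonicity, at every `δ' ≤ δ`). -/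
theorem not_halfSumFeasible_of_deepSite {δ : ℝ} {N : ℕ} (x : Fin N → EuclideanSpace ℝ (Fin 3)) (hx : Sep δ x)
    (i : Fin N) (hdeep : (∑ j ∈ Finset.univ.erase i, lennardJones (dist (x i) (x j))) / 2 < twoConeB) :
    ∀ δ' : ℝ, δ' ≤ δ → ¬ HalfSumFeasible δ' := fun _ hδ' hf =>
  absurd (twoConeB_le_eInf.trans (halfSumFeasible_mono hδ' hf N x hx i)) (not_le.mpr hdeep)

/-! ## The bracket of `…RadiusLadderHalfRule`, restated for the threshold set -/

/-- `[4/3, ∞) ⊆ {δ | HalfSumFeasible δ}`. -/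
theorem halfSumFeasible_of_four_thirds_le {δ : ℝ} (h : 4 / 3 ≤ δ) : HalfSumFeasible δ :=
  (feasible_halfRule_iff δ 0).1 (feasible_mono_sep h (feasible_halfRule_four_thirds 0))

/-- `(-∞, 23/25] ∩ {δ | HalfSumFeasible δ} = ∅` (centre of `Star959`). -/
theorem not_halfSumFeasible_of_le_23_25 {δ : ℝ} (h : δ ≤ 23 / 25) : ¬ HalfSumFeasible δ :=
  fun hf => not_feasible_halfRule_of_le h 0 ((feasible_halfRule_iff δ 0).2 hf)

/-- **The small-radius rungs, decided outside `(23/25, 4/3)`**: for `0 < R < δ`, `RungAt δ R` holds if `δ ≥ 4/3`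
and fails if `δ ≤ 23/25`; in between it is the single open inequality `HalfSumFeasible δ`. -/
theorem rungAt_lt_sep_decided {δ R : ℝ} (hδ : 0 < δ) (hR : R < δ) :
    (4 / 3 ≤ δ → RungAt δ R) ∧ (δ ≤ 23 / 25 → ¬ RungAt δ R) ∧ (RungAt δ R ↔ HalfSumFeasible δ) :=
  ⟨fun h => rungAt_of_halfSumFeasible (halfSumFeasible_of_four_thirds_le h) R,
    fun h hr => not_halfSumFeasible_of_le_23_25 h (halfSumFeasible_of_rungAt hδ hR hr),
    rungAt_iff_halfSumFeasible_of_lt hδ hR⟩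

end Summit.AtomisticToContinuum.Crystallization.Theorems.StrictSplittingRuleBirth

end
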